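import Mathlib
import HarnessLib
import Summits.ResolutionOfSingularities.ResolutionOfSingularities.Theorems.WildQuotientsWildQuotientResolutionS1aSectionGlueKill

/-!
# S1a — ONE-MOVE KILL BY A GLUED PRINCIPAL CENTRE PRESENTED BY SECTIONS: the ASSOCIATED-GENERATORS form (`killsIn_one_of_sectionCharts_of_associated`)

[OURS · L1 W4.5c · crux stmt-ResolutionOfSingularities-17941 `CyclicQuotientFourfolds`, line `s1a-logminvertex` v13 (`stub_reachLowerInFX`); R4c cusp, assembly step
(b6) of `Lines/s1a_logminvertex-R4c-PROGRESS.md`] — NOT statements of the manuscript; counted 0; AI-level work, weaker than expert review.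

WHY: ✓`GameFrame.GModel.killsIn_one_of_sectionCharts` (R4e) glues the chart filtrations through sections `R i l` with `a i l · R i l = glob l|O i` that are
INVERTIBLE on every overlap `O i ∩ O j` (`hRunit`). That hypothesis cannot hold between two member charts OF THE SAME POINT (R4c: `U_{Q,1} ⊂ [N(y)]` and
`U_{Q,2} ⊂ [v]` at the tangency point `Q` of the cusp, ✓`exists_cuspQ_memberChart_rel` / ✓`exists_cuspQv_memberChart_rel`): there `a·R = π^*x₀` with `a` of degree
`0`, so `R` vanishes on the exceptional divisor, which meets `U_{Q,1} ∩ U_{Q,2}`. The proof of the R4e lemma uses `glob/R/hR/hRunit` ONLY to derive that neighbouring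
generators are associated on affine opens of the overlaps; this file states the kill lemma with that conclusion (`hass`) as the hypothesis, and supplies the
second way of discharging it: on an INTEGRAL scheme, `a₁·(ζ^e)|W₁ = g|W₁` and `a₂·(ζ^e)|W₂ = g|W₂` with a global `ζ ≠ 0` force `a₁|U = a₂|U`
(`Scheme.map_eq_map_of_mul_pow_eq`, cancellation in the domain `Γ(U)`), no unit needed.
* `AlgebraicGeometry.Scheme.map_eq_map_of_mul_pow_eq` (dot-notation extension of Mathlib's `Scheme` namespace, as ✓`Scheme.isUnit_map_of_le_basicOpen`);
* ★★ `GameFrame.GModel.killsIn_one_of_sectionCharts_of_associated`.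
-/

set_option linter.dupNamespace false

noncomputable section

open CategoryTheory Limits AlgebraicGeometry TopologicalSpace Topology Opposite
open Literature.AlgebraicGeometry.Resolution Literature.AlgebraicGeometry.RelativeSpec
open Summit.ResolutionOfSingularities.ResolutionOfSingularities.Theorems.WildQuotientResolution.S1
open Summit.ResolutionOfSingularities.ResolutionOfSingularities.Theorems.WildQuotientResolution.S1.NodeAtlas
open Summit.ResolutionOfSingularities.ResolutionOfSingularities.Theorems.WildQuotientResolution.S1.NpFrame
open Summit.ResolutionOfSingularities.ResolutionOfSingularities.Theorems.WildQuotientResolution.S1.KillGlue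

namespace AlgebraicGeometry.Scheme

/-- **Cancellation of a common global factor on an integral scheme** (deliberate dot-notation extension of Mathlib's `AlgebraicGeometry.Scheme`
namespace): if `a₁ · (ζ|W₁)^e = g|W₁` and `a₂ · (ζ|W₂)^e = g|W₂` for global sections `ζ ≠ 0`, `g` of an integral scheme `V`, then `a₁|U = a₂|U` on every
open `U ≤ W₁`, `U ≤ W₂` (for `U = ∅` trivially; otherwise `Γ(V, U)` is a domain and `ζ|U ≠ 0` by `map_injective_of_isIntegral`). [folklore] -/
theorem map_eq_map_of_mul_pow_eq {V : Scheme} [IsIntegral V] {W₁ W₂ U : V.Opens} (h1 : U ≤ W₁) (h2 : U ≤ W₂)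
    (a₁ : Γ(V, W₁)) (a₂ : Γ(V, W₂)) (ζ g : Γ(V, ⊤)) (hζ : ζ ≠ 0) (e : ℕ)
    (hR₁ : a₁ * (V.presheaf.map (homOfLE (le_top : W₁ ≤ ⊤)).op).hom ζ ^ e = (V.presheaf.map (homOfLE (le_top : W₁ ≤ ⊤)).op).hom g)
    (hR₂ : a₂ * (V.presheaf.map (homOfLE (le_top : W₂ ≤ ⊤)).op).hom ζ ^ e = (V.presheaf.map (homOfLE (le_top : W₂ ≤ ⊤)).op).hom g) :
    (V.presheaf.map (homOfLE h1).op).hom a₁ = (V.presheaf.map (homOfLE h2).op).hom a₂ := by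
  by_cases hbot : U = ⊥
  · haveI : Subsingleton Γ(V, U) := CommRingCat.subsingleton_of_isTerminal (V.sheaf.isTerminalOfEqEmpty hbot)
    exact Subsingleton.elim _ _
  · haveI : Nonempty U := ((Opens.ne_bot_iff_nonempty U).mp hbot).to_subtype
    have hc : ∀ {W : V.Opens} (h : U ≤ W) (x : Γ(V, ⊤)),
        (V.presheaf.map (homOfLE h).op).hom ((V.presheaf.map (homOfLE (le_top : W ≤ ⊤)).op).hom x) =
          (V.presheaf.map (homOfLE (le_top : U ≤ ⊤)).op).hom x := by
      intro W h x
      rw [← CommRingCat.comp_apply, ← Functor.map_comp]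
      rfl
    have e₁ := congrArg (V.presheaf.map (homOfLE h1).op).hom hR₁
    have e₂ := congrArg (V.presheaf.map (homOfLE h2).op).hom hR₂
    simp only [map_mul, map_pow, hc] at e₁ e₂
    have hζU : (V.presheaf.map (homOfLE (le_top : U ≤ ⊤)).op).hom ζ ≠ 0 := fun h0 =>
      hζ (map_injective_of_isIntegral V (homOfLE (le_top : U ≤ ⊤)) (by rw [h0, map_zero]))
    exact mul_right_cancel₀ (pow_ne_zero e hζU) (e₁.trans e₂.symm)

end AlgebraicGeometry.Scheme

namespace Summit.ResolutionOfSingularities.ResolutionOfSingularities.Theorems.WildQuotientResolution.S1.GameFrame.GModel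

variable {p : ℕ} {X' X₁ : Scheme.{0}} {q : X' ⟶ X₁} {G : Type} [Group G] {ρ : G →* Aut X'} {g₀ : G}

set_option maxHeartbeats 800000 in
/-- ★★ **ONE-MOVE KILL BY A GLUED PRINCIPAL CENTRE PRESENTED BY SECTIONS ON SEVERAL CHARTS — associated-generators form.** As
✓`killsIn_one_of_sectionCharts`, but the gluing hypothesis is stated directly as `hass`: on every affine `U` inside an overlap `O i ∩ O j` the restricted
generators `a i l|U`, `a j l|U` are ASSOCIATED (dischargeable EITHER by units as in R4e — `associated_of_mul_unit_eq` + `Scheme.isUnit_map_of_le_basicOpen` —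
OR by equality via `Scheme.map_eq_map_of_mul_pow_eq` for two charts of the same point). Then `KillsIn 1 M`. Proof verbatim from the R4e lemma after its
`hagree` step. [OURS · L1 W4.5c · R4c (b6); NOT a statement of the manuscript] -/
theorem killsIn_one_of_sectionCharts_of_associated [Finite G] (hp : p.Prime) (hG : ∀ g : G, g ∈ Subgroup.zpowers g₀)
    {k : Type} [Field k] (f : X₁ ⟶ Spec (.of k)) [LocallyOfFiniteType f] [IsFinite q]
    (M : GModel p q G ρ g₀) [M.V.IsSeparated] (𝔄 : NodeAtlasData p M.act g₀)
    {η : Type} [Finite η] (O : η → M.act.StableAffineOpens) (𝒦₀ : η → ReesFiltration M.V) {d : ℕ} (hd : 0 < d)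
    (hprin : ∀ i, IsPrincipalCentreChart p M.act g₀ (𝒦₀ i) d (O i))
    {c : ℕ} (w : Fin c → ℕ) (hw : ∀ l, 0 < w l) (a : ∀ i, Fin c → Γ(M.V, (O i).1))
    (hsec : ∀ i (U : M.V.affineOpens) (hU : U.1 ≤ (O i).1) (n : ℕ),
      ((𝒦₀ i).filtration U).ideal n = (weightedFiltration (fun l => (M.V.presheaf.map (homOfLE hU).op).hom (a i l)) w).ideal n)
    (hass : ∀ i j, i ≠ j → ∀ (U : M.V.affineOpens) (hi : U.1 ≤ (O i).1) (hj : U.1 ≤ (O j).1) (l : Fin c),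
      Associated ((M.V.presheaf.map (homOfLE hi).op).hom (a i l)) ((M.V.presheaf.map (homOfLE hj).op).hom (a j l)))
    {A : Type} (Uc : A → M.V.Opens) (hcov : ∀ x : M.V, (x ∈ ⋃ i, ((O i).1 : Set M.V)) ∨ ∃ a', x ∈ Uc a')
    (hunit : ∀ a' i, ∃ l, ∀ v ∈ (O i).1, v ∈ Uc a' → v ∈ M.V.basicOpen (a i l))
    (hF : 𝔄.fLocus ⊆ ⋃ i, ((O i).1 : Set M.V)) : KillsIn 1 M := by
  classical
  haveI : Fintype η := Fintype.ofFinite η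
  have hO : ∀ i, IsAffineOpen (O i).1 := fun i => (hprin i).1
  -- agreement on overlaps: associated generators
  have hagree : ∀ i j (U : M.V.affineOpens), U.1 ≤ (O i).1 → U.1 ≤ (O j).1 → ∀ n, ((𝒦₀ i).filtration U).ideal n = ((𝒦₀ j).filtration U).ideal n := by
    intro i j U hi hj n
    rw [hsec i U hi n, hsec j U hj n]
    refine CoarseChart.weightedFiltration_eq_of_associated _ _ w (fun l => ?_) n
    by_cases hij : i = j
    · subst hij; exact Associated.refl _
    · exact hass i j hij U hi hj l
  -- the closed set `B`
  let B : Set M.V := ⋃ i, closure (M.V.zeroLocus (U := (O i).1) (Set.range (a i)) ∩ ((O i).1 : Set M.V))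
  have hBc : IsClosed B := isClosed_iUnion_of_finite fun i => isClosed_closure
  have hBcov : B ⊆ ⋃ i, ((O i).1 : Set M.V) := by
    refine Set.iUnion_subset fun i => ?_
    choose l hl using fun a' => hunit a' i
    exact Scheme.closure_zeroLocus_inter_subset_of_cover_of_subset (O i).1 (⋃ j, ((O j).1 : Set M.V)) Uc hcov (Set.range (a i)) (fun a' => a i (l a'))
      (fun a' => ⟨1, one_pos, by rw [pow_one]; exact ⟨l a', rfl⟩⟩) (fun a' v hv hva => hl a' v hv hva)
  have hsupp : ∀ i, (((𝒦₀ i).ideal d).support : Set M.V) ∩ (O i).1 ⊆ B := by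
    intro i v ⟨hvs, hvO⟩
    refine Set.mem_iUnion.mpr ⟨i, subset_closure ⟨?_, hvO⟩⟩
    have hz := (Scheme.IdealSheafData.mem_support_iff_of_mem (I := (𝒦₀ i).ideal d) (U := ⟨(O i).1, hO i⟩) hvO).mp hvs
    rw [Scheme.mem_zeroLocus_iff] at hz ⊢
    rintro _ ⟨l, rfl⟩ hv
    have hmem : a i l ^ d ∈ ((𝒦₀ i).ideal d).ideal ⟨(O i).1, hO i⟩ := by
      rw [← ReesFiltration.filtration_ideal, hsec i ⟨(O i).1, hO i⟩ le_rfl d]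
      have hal : (M.V.presheaf.map (homOfLE (le_refl (O i).1)).op).hom (a i l) = a i l := by
        have : (homOfLE (le_refl (O i).1)).op = 𝟙 _ := rfl
        rw [this, M.V.presheaf.map_id]; rfl
      have h1 : a i l ∈ (weightedFiltration (fun l => (M.V.presheaf.map (homOfLE (le_refl (O i).1)).op).hom (a i l)) w).ideal (w l) := by
        have := mem_weightedFiltration_ideal (fun l => (M.V.presheaf.map (homOfLE (le_refl (O i).1)).op).hom (a i l)) w l
        rwa [hal] at this
      have h2 : a i l ^ d ∈ (weightedFiltration (fun l => (M.V.presheaf.map (homOfLE (le_refl (O i).1)).op).hom (a i l)) w).ideal (w l * d) :=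
        Veronese.idealFiltration_pow_le _ (w l) d (Ideal.pow_mem_pow h1 d)
      exact (weightedFiltration (fun l => (M.V.presheaf.map (homOfLE (le_refl (O i).1)).op).hom (a i l)) w).antitone (Nat.le_mul_of_pos_left d (hw l)) h2
    exact hz _ hmem (by rw [Scheme.basicOpen_pow _ _ hd]; exact hv)
  obtain ⟨J, hJ, -, hJO, -⟩ := exists_isPrincipalCentre_of_agree_filtration_eq hG M O hO 𝒦₀ hd hprin hagree hBc hBcov hsupp
  refine killsIn_one_of_disjointPrincipalFamily_datum hp hG f M 𝔄 (fun _ : Unit => J) hd (fun _ => hJ) ?_ (fun _ : η => ()) O (fun i => hJO i) ?_ hF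
  · intro i j hij; exact absurd (Subsingleton.elim i j) hij
  · intro c j hj; exact absurd (Subsingleton.elim j ()) hj

/-- **The R4e unit form implies the associated form** (bridge, so both kill lemmas share consumers): sections `R i l` with `a i l · R i l = glob l|O i`,
invertible on `O i ∩ O j` for `i ≠ j`, give `hass`. [OURS · L1 W4.5c] -/
theorem associated_sections_of_units (M : GModel p q G ρ g₀) {η : Type} (O : η → M.act.StableAffineOpens)
    {c : ℕ} (a : ∀ i, Fin c → Γ(M.V, (O i).1)) (glob : Fin c → Γ(M.V, ⊤)) (R : ∀ i, Fin c → Γ(M.V, (O i).1))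
    (hR : ∀ i l, a i l * R i l = (M.V.presheaf.map (homOfLE le_top).op).hom (glob l))
    (hRunit : ∀ i j, i ≠ j → ∀ l, ∀ v ∈ (O i).1, v ∈ (O j).1 → v ∈ M.V.basicOpen (R i l)) :
    ∀ i j, i ≠ j → ∀ (U : M.V.affineOpens) (hi : U.1 ≤ (O i).1) (hj : U.1 ≤ (O j).1) (l : Fin c),
      Associated ((M.V.presheaf.map (homOfLE hi).op).hom (a i l)) ((M.V.presheaf.map (homOfLE hj).op).hom (a j l)) := by
  intro i j hij U hi hj l
  have hgi := congrArg (M.V.presheaf.map (homOfLE hi).op).hom (hR i l)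
  have hgj := congrArg (M.V.presheaf.map (homOfLE hj).op).hom (hR j l)
  rw [map_mul, ← CommRingCat.comp_apply, ← Functor.map_comp] at hgi hgj
  have heq : (M.V.presheaf.map (homOfLE hi).op).hom (a i l) * (M.V.presheaf.map (homOfLE hi).op).hom (R i l) =
      (M.V.presheaf.map (homOfLE hj).op).hom (a j l) * (M.V.presheaf.map (homOfLE hj).op).hom (R j l) := by
    rw [hgi, hgj]; rfl
  exact associated_of_mul_unit_eq
    (Scheme.isUnit_map_of_le_basicOpen (R i l) hi fun v hv => hRunit i j hij l v (hi hv) (hj hv))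
    (Scheme.isUnit_map_of_le_basicOpen (R j l) hj fun v hv => hRunit j i (Ne.symm hij) l v (hj hv) (hi hv)) heq

/-- **Global-normaliser form ⇒ the associated form** (the R4c cusp assembly's discharge of `hass`): on an INTEGRAL model, if every chart's sections
satisfy `a i l · ((ζ|W i)|O i)^(e l) = (glob l|W i)|O i` for GLOBAL sections `ζ ≠ 0`, `glob l` (restricted in two steps through an intermediate open
`W i ⊇ O i`, exactly as ✓`exists_cuspO_memberChart_rel_xi` / ✓`exists_cuspQ_memberChart_rel` / ✓`exists_cuspQv_memberChart_rel` export them with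
`rξ := ζ|W`, `r0, rt := glob|W`), then neighbouring generators are EQUAL, hence associated, on every open of every overlap — for all pairs of charts,
same point or not. [OURS · L1 W4.5c · R4c (b6)] -/
theorem associated_sections_of_mul_pow_eq_global (M : GModel p q G ρ g₀) [IsIntegral M.V] {η : Type} (O : η → M.act.StableAffineOpens)
    (W : η → M.V.Opens) (hOW : ∀ i, (O i).1 ≤ W i)
    {c : ℕ} (a : ∀ i, Fin c → Γ(M.V, (O i).1)) (ζ : Γ(M.V, ⊤)) (hζ : ζ ≠ 0) (glob : Fin c → Γ(M.V, ⊤)) (e : Fin c → ℕ)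
    (hR : ∀ i l, a i l * (M.V.presheaf.map (homOfLE (hOW i)).op).hom ((M.V.presheaf.map (homOfLE (le_top : W i ≤ ⊤)).op).hom ζ) ^ e l =
      (M.V.presheaf.map (homOfLE (hOW i)).op).hom ((M.V.presheaf.map (homOfLE (le_top : W i ≤ ⊤)).op).hom (glob l))) :
    ∀ i j, i ≠ j → ∀ (U : M.V.affineOpens) (hi : U.1 ≤ (O i).1) (hj : U.1 ≤ (O j).1) (l : Fin c),
      Associated ((M.V.presheaf.map (homOfLE hi).op).hom (a i l)) ((M.V.presheaf.map (homOfLE hj).op).hom (a j l)) := by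
  have hc : ∀ (i : η) (x : Γ(M.V, ⊤)), (M.V.presheaf.map (homOfLE (hOW i)).op).hom ((M.V.presheaf.map (homOfLE (le_top : W i ≤ ⊤)).op).hom x) =
      (M.V.presheaf.map (homOfLE (le_top : (O i).1 ≤ ⊤)).op).hom x := by
    intro i x
    rw [← CommRingCat.comp_apply, ← Functor.map_comp]
    rfl
  intro i j _ U hi hj l
  have hRi := hR i l
  have hRj := hR j l
  rw [hc, hc] at hRi hRj
  rw [Scheme.map_eq_map_of_mul_pow_eq hi hj (a i l) (a j l) ζ (glob l) hζ (e l) hRi hRj]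

end Summit.ResolutionOfSingularities.ResolutionOfSingularities.Theorems.WildQuotientResolution.S1.GameFrame.GModel

end
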